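import Literature.NumberTheory.EllipticCurves.Tian2014.CMPointSystemDisplays
import Literature.NumberTheory.EllipticCurves.Tian2014.CMPointSystemMonskyDescent
import Literature.NumberTheory.EllipticCurves.Tian2014.CMPointSystemFourTorsion
import HarnessLib

/-!
# Tian 2014 §2 / §4.1 AS PRINTED — the CM-point system `(H, 𝒜, σ_t, conj, z_t)` for `n ≡ 1 (mod 4)`:
# Def. 2.3, Thm. 2.4 (1)–(3), the Galois facts — DISPLAYS on DATA; the trace point `y₀ = Σ_{t ∈ 2𝒜} z_t` of
# §4.1 (`y_{p₀}` for `n = p₀`), the REAL twist transfer `E_n(ℚ) → E(H)` along `√n`, and `E(H)[4] = E[2]`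

Cell `bsd-monsky` (prover-A seat, g14; `run/shared/lean/pub/bsd-monsky/`). Sibling of `CMPointSystemDisplays.lean`
(Tian's Thm. 2.8 system for `n ≡ 3 (mod 4)`, the system of the cell's enclosure). HONEST FRAMING (README §1): nothing
asserted, no named fact, nothing booked; every `def … : Prop` is a displayed printed sentence with its locator
(arXiv:1210.8231 `pNNNN LMM` = page:line of the materialised text); the existence of such data is NOT filed as a fact
— the theorems built on it (`CMPointSystemDescentPrimeFive.lean`, the `P2` door) take it as an explicit BINDER, as the
cell's one-prime files of g13 do (net debt 0). Purpose: Tian's §4.1 (Monsky's `D ≡ 1 (mod 4)` sections 2–3) — the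
one-prime case `p₀ ≡ 5 (mod 8)` (Prop. 4.2 = Monsky Thm. 3.6, Cor. 5.15 (1) «`p₅`»), the only one-prime family of
Cor. 5.15 (1) outside the data of `CMPointSystemDisplays` (`p₇`, `2p₇`, `2p₃` are g13's).

## Source (verbatim, arXiv:1210.8231)

* Def. 2.3 (p0008 L59–L66): "Let `n ≡ 1 mod 4` be a positive integer and `K = ℚ(√−2n)`. Let `P ∈ X₀(32)(K^ab)` be
  the image of `i√2n/8` under the complex uniformization `ℋ → X₀(32)`. Define the CM point on `E`
  `z := f(P) + (1 + √2, 2 + √2) ∈ E(K^ab)`. For each `t ∈ K̂ˣ`, let `z_t` denote the Galois conjugation `z^{σ_t}` of `z`."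
* Thm. 2.4 (p0008 L68–L75): "Assume that `n ≡ 1 mod 4` is a positive integer. Then, for each `t ∈ K̂ˣ`, we have
  (1) the point `z_t` is defined over the Hilbert class field `H` of `K` and only depends on the class of `t` modulo
  `Kˣ Ô_Kˣ`; (2) the complex conjugation of `z_t`, denoted by `z̄_t`, is equal to `z_{t⁻¹}`; and (3) `z_{ϖt} + z_t = 0`
  or `(0, 0)` according to `n ≡ 1 mod 8` or `≡ 5 mod 8`." Remark 2.5: "The CM points `z_t` above are essentially the
  same as those Monsky studied in [19] using modular functions on `X(8)`."
* §4 (p0019 L40–L43): "Recall that `K = ℚ(√−2n)` and `ϖ = √−2n ∈ K₂ˣ` is a uniformizor at `2`." §4.1 (p0019 L44–L48):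
  "We first handle the case with `p₀ ≡ 5 mod 8`. In this case, `m = n` and the condition (1.1) in Theorem 1.3 says that
  the ideal class group `𝒜` of `K = ℚ(√−2n)` has no order `4` elements, or equivalently that `2𝒜 ≅ Gal(H/H₀)` has odd
  cardinality." (4.1) (p0019 L62–L63): "`y_n = Tr_{H/K(√n)} z ∈ E(K(√n))`." Prop. 4.2 proof (p0020 L1–L6): "In this
  case `K(√p₀) = H₀` and the ideal class group `𝒜` of `K = ℚ(√−2p₀)` satisfies that `2𝒜 ≅ Gal(H/H₀)` has odd
  cardinality. Note that the action of the complex conjugation on `Gal(H/K)` is given by inverse and `Gal(H/K(√p₀))` is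
  stable under this action. It follows that the point `y_{p₀} = Tr_{H/K(√p₀)} z` is fixed by the action of complex
  conjugation and therefore `y_{p₀} ∈ E(ℚ(√p₀))`." (p0020 L10–L11): "For any `t ∈ K̂ˣ`, we have that `z_{ϖt} + z_t =
  (0, 0)` by Theorem 2.4 (3)." (p0020 L19–L21): "`y_{p₀} − y′ ∈ E[4] ∩ E(ℚ(√p₀)) = E[2]`."
* Prop. 2.6 (2) (p0009 L11–L14): "The extension `H′/K` is anticyclotomic in the sense that `H′` is Galois over `ℚ`
  such that the nontrivial involution on `K` over `ℚ` acts on `Gal(H′/K)` by the inverse."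
* §2 (p0008 L34–L40): "the set of torsion points with exact order `4` on `E` is the union of the following subsets:
  `(i, 1 − i) + E[2]`, `(1 + √2, 2 + √2) + E[2]`, and `(−1 − √2, i(2 + √2)) + E[2]`, whose doubles are `(0, 0)`,
  `(1, 0)`, and `(−1, 0)`, respectively."

## Transcription (tree dictionary; as in `CMPointSystemDisplays`)
* `E : y² = x³ − x` is `congruentNumberCurve 1`; `E(H)` = `EPoint H`; `(0,0), (1,0), (−1,0)` = `ptZero`, `ptOne`,
  `ptNegOne`. `𝒜 = Cl(K)`, `K = ℚ(√−2n)`: `ClassGroup (𝓞 (GenusField (2 * n)))`.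
* `H`: an abstract number field, Galois over `ℚ`, with `√−2n ∈ H`; "`σ_t`" = a group homomorphism `art : 𝒜 →* Aut(H/ℚ)`
  (the Artin map onto `Gal(H/K)`, Thm. 2.4 (1): `z_t` "only depends on the class of `t`"); `[ϖ] ∈ 𝒜` = `piClass`
  (the class of the prime `𝔭₂ = (2, √−2n)` above `2`, `𝔭₂² = (2)`); complex conjugation = `conj`.
* "`E(ℚ(√n))⁻ ≅ E^{(n)}(ℚ)`" for the REAL quadratic field `ℚ(√n)`: `transferEPos n θ : E_n(ℚ) →+ E(H)`,
  `(x, y) ↦ (x/θ², y/θ³)` with `θ² = +n` (the tree's `transferE` is the same map for `θ² = −N`; `E_N` is the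
  quadratic twist of `E` by `+N` as well as by `−N`, since `a₂ = a₆ = 0`).
* "`2𝒜 ≅ Gal(H/H₀)`, `H₀ = K(√p₀)`" and "`i ∉ H`" are NOT fields of the structure: the descent theorems take them as
  binders on an element `θ = √p₀ ∈ H` (`∀ s, σ_s θ = θ ↔ IsSquare s`) and on `H` (`∀ x, x² ≠ −1`).

[cite: Tian2014, Def. 2.3 (arXiv:1210.8231 p0008 L59–L66), Thm. 2.4 (p0008 L68–L75), Rem. 2.5 (p0008 L76–L79), Prop. 2.6 (2) (p0009 L11–L14), §4.1 (p0019 L44–L63), Prop. 4.2 and its proof (p0019 L74–p0020 L22)]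
[cite: Monsky1990MockHeegner, Def. 2.9 and Thm. 2.8 (pp. 50–51), Def. 3.4, Thm. 3.5, Thm. 3.6 (p. 53)]
-/

noncomputable section

open scoped Classical

open WeierstrassCurve NumberField Literature.NumberTheory.EllipticCurves
  Literature.NumberTheory.EllipticCurves.TianYuanZhang2017
open Literature.NumberTheory.EllipticCurves.Monsky1990 (baseChange_coeffs negY_eq sq_eq_of_nonsingular
  exists_two_nsmul_some_eq eq_of_two_nsmul_eq_zero rho)

set_option autoImplicit false

namespace Literature.NumberTheory.EllipticCurves.Tian2014

/-! ## §1 The data of Tian 2014 §2 / §4.1 for `n ≡ 1 (mod 4)` (objects only; nothing asserted) -/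

/-- **The objects of Tian 2014 Def. 2.3 / Thm. 2.4 / §4.1 for `n ≡ 1 (mod 4)`** (`K = ℚ(√−2n)`): the Hilbert class
field `H` of `K` (Galois over `ℚ`), `ϖ = √−2n ∈ K ⊂ H`, the Artin map `art : 𝒜 = Cl(K) → Aut(H/ℚ)` (`t ↦ σ_t`; Thm. 2.4
(1): `z_t` "only depends on the class of `t` modulo `Kˣ Ô_Kˣ`"), the class `[ϖ] = [𝔭₂]` of the uniformizer `ϖ` at `2`
(`piClass`), complex conjugation (`conj`), and the CM points `z_t` (`z`).
[cite: Tian2014, Def. 2.3 (p0008 L59–L66), Thm. 2.4 (p0008 L68–L75), §4 (p0019 L40–L43)] -/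
structure CMPointDataOne (n : ℕ) : Type 1 where
  /-- the Hilbert class field `H` of `K = ℚ(√−2n)` -/
  H : Type
  [instField : Field H]
  [instNumberField : NumberField H]
  [instIsGalois : IsGalois ℚ H]
  /-- `ϖ = √−2n ∈ K ⊂ H` -/
  sqrtNegTwoN : H
  sqrtNegTwoN_sq : sqrtNegTwoN ^ 2 = -((2 * n : ℕ) : H)
  /-- the Artin map `t ↦ σ_t` on ideal classes -/
  art : ClassGroup (𝓞 (GenusField (2 * n))) →* (H ≃ₐ[ℚ] H)
  /-- the class `[ϖ]` of the uniformizer `ϖ = √−2n` at `2` (= the prime `𝔭₂` above `2`) -/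
  piClass : ClassGroup (𝓞 (GenusField (2 * n)))
  /-- complex conjugation on `H` -/
  conj : H ≃ₐ[ℚ] H
  /-- the CM points `z_t`, `t ∈ 𝒜` -/
  z : ClassGroup (𝓞 (GenusField (2 * n))) → EPoint H

attribute [instance] CMPointDataOne.instField CMPointDataOne.instNumberField CMPointDataOne.instIsGalois

namespace CMPointDataOne

variable {n : ℕ}

/-- `σ` acting on `E(H)` (the standard action `Affine.Point.map` of `σ ∈ Aut(H/ℚ)` on the `H`-points of the
`ℚ`-curve `E`; additive). [cite: Tian2014, Def. 2.3 (p0008 L65–L66: z_t := z^{σ_t})] -/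
def act (D : CMPointDataOne n) (σ : D.H ≃ₐ[ℚ] D.H) : EPoint D.H →+ EPoint D.H :=
  WeierstrassCurve.Affine.Point.map σ.toAlgHom

/-- `σ ↦ σ_*` is multiplicative: `(στ)_* = σ_* ∘ τ_*`. [cite: Tian2014, Def. 2.3 (p0008 L65–L66)] [folklore] -/
theorem act_mul (D : CMPointDataOne n) (σ τ : D.H ≃ₐ[ℚ] D.H) (P : EPoint D.H) :
    D.act (σ * τ) P = D.act σ (D.act τ P) := by
  unfold act
  rw [WeierstrassCurve.Affine.Point.map_map]
  rfl

/-- `1_* = id`. [cite: Tian2014, Def. 2.3 (p0008 L65–L66)] [folklore] -/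
theorem act_one (D : CMPointDataOne n) (P : EPoint D.H) : D.act 1 P = P := by
  unfold act
  exact WeierstrassCurve.Affine.Point.map_id P

/-! ## §2 The printed statements as predicates on the data -/

/-- **Thm. 2.4 (2)**: "the complex conjugation of `z_t`, denoted by `z̄_t`, is equal to `z_{t⁻¹}`".
[cite: Tian2014, Thm. 2.4 (2) (p0008 L72–L73)] -/
def thm24_2 (D : CMPointDataOne n) : Prop :=
  ∀ t, D.act D.conj (D.z t) = D.z t⁻¹

/-- **Thm. 2.4 (3)**: "`z_{ϖt} + z_t = 0` or `(0, 0)` according to `n ≡ 1 mod 8` or `≡ 5 mod 8`".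
[cite: Tian2014, Thm. 2.4 (3) (p0008 L74–L75)] -/
def thm24_3 (D : CMPointDataOne n) : Prop :=
  ∀ t, D.z (D.piClass * t) + D.z t = if n % 8 = 5 then ptZero else 0

/-- **Def. 2.3, the Galois conjugates**: "`z_t` denote[s] the Galois conjugation `z^{σ_t}` of `z`", so that
`σ_s(z_t) = z^{σ_t σ_s} = z_{st}` (`σ_s σ_t = σ_{st}`, the Artin map being a homomorphism; `𝒜` abelian) — the
`n ≡ 1 (mod 4)` form of (4.8). [cite: Tian2014, Def. 2.3 (p0008 L65–L66), (4.8) (p0023 L46–L50)] -/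
def def23 (D : CMPointDataOne n) : Prop :=
  ∀ s t, D.act (D.art s) (D.z t) = D.z (s * t)

/-- **The Galois facts of §2 / §4.1 that the descent consumes** (two sentences; nothing idle): `Gal(H/ℚ)` is
generated by `Gal(H/K) = {σ_t}` and complex conjugation (`H/ℚ` Galois, `H ⊇ K` imaginary quadratic with
`Gal(H/K) = 𝒜` through the Artin map, Thm. 2.4 (1); Prop. 2.6 (2): "the nontrivial involution on `K` over `ℚ` acts on
`Gal(H′/K)` by the inverse"; p0020 L3–L4: "the action of the complex conjugation on `Gal(H/K)` is given by inverse");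
and `[ϖ]` has order `2` in `𝒜` (`ϖ` a uniformizer at the ramified prime `2`: `[𝔭₂]² = [(2)] = 1`) with `[ϖ] ≠ 1`
(`x² + 2ny² = 2` has no solution for `n > 1`; Monsky: "`m` is ambiguous"). The sentences "`σ_t` fixes `√−2n`" and
"complex conjugation moves `√−2n`" are NOT displayed: the one-prime descent does not consume them.
[cite: Tian2014, Thm. 2.4 (1) (p0008 L69–L71), Prop. 2.6 (2) (p0009 L11–L14), §4 (p0019 L40–L43), Prop. 4.2 proof (p0020 L1–L6)]
[cite: Monsky1990MockHeegner, p. 51 ("m is ambiguous"), Thm. 3.6 proof (p. 53)] -/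
def galoisFacts (D : CMPointDataOne n) : Prop :=
  (∀ σ : D.H ≃ₐ[ℚ] D.H, σ ∈ Subgroup.closure (Set.range D.art ∪ {D.conj})) ∧
  (D.piClass * D.piClass = 1 ∧ D.piClass ≠ 1)

/-- The conjunction of the displayed statements of Tian 2014 §2 / §4.1 for the data `D`.
[cite: Tian2014, Def. 2.3 (p0008 L59–L66), Thm. 2.4 (p0008 L68–L75), Prop. 2.6 (2) (p0009 L11–L14)] -/
def Printed (D : CMPointDataOne n) : Prop :=
  D.thm24_2 ∧ D.thm24_3 ∧ D.def23 ∧ D.galoisFacts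

/-! ## §3 Derived objects: the trace point `y₀ = Σ_{t ∈ 2𝒜} z_t` -/

/-- **The trace point `y₀ := Tr_{H/H₀} z = Σ_{t ∈ 2𝒜} z_t`** over the principal genus `2𝒜 ≅ Gal(H/H₀)` (the
squares of `𝒜`; Gauss). For `n = p₀` prime this is Tian's `y_{p₀} = Tr_{H/K(√p₀)} z` of (4.1) (`K(√p₀) = H₀`,
p0020 L1–L2); for general `n` it is the `y₀ = Tr_{H/H₀} z` of Lemma 4.3 (p0020 L31).
[cite: Tian2014, (4.1) (p0019 L62–L63), Prop. 4.2 proof (p0020 L1–L6), Lemma 4.3 (p0020 L31)] -/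
def yZero (D : CMPointDataOne n) : EPoint D.H :=
  ∑ t ∈ (Finset.univ.filter fun t : ClassGroup (𝓞 (GenusField (2 * n))) => IsSquare t), D.z t

/-- `√−2n ≠ 0` for `n ≠ 0`. [cite: Tian2014, Def. 2.3 (p0008 L59–L60)] [folklore] -/
theorem sqrtNegTwoN_ne_zero (D : CMPointDataOne n) (hn : n ≠ 0) : D.sqrtNegTwoN ≠ 0 := by
  intro h
  have h2 := D.sqrtNegTwoN_sq
  rw [h, zero_pow two_ne_zero, zero_eq_neg, Nat.cast_eq_zero] at h2
  omega

end CMPointDataOne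

/-! ## §4 The REAL twist transfer `E_N(ℚ) →+ E(H)` along `θ = √N` (`θ² = +N`) -/

section TransferPos

/-- `E_N : y² = x³ − N²x` is ALSO the quadratic twist of `E : y² = x³ − x` by `+N` (as equations; `a₂ = a₆ = 0`, and
the twist by `d` has `a₄ = d²·(−1)`): the two twists by `±N` are the same Weierstrass equation. (The same identity is
`Summit.BirchSwinnertonDyer.Rank1Residual.P2.congruentNumberCurve_eq_quadraticTwist` of `P2/WindowsAtTwo.lean` — a
Summits module, which a Literature module cannot import; restated here next to the tree's `−N` form.)
[cite: Tian2014, §1 (p0001 L24–L26: E^{(n)} the twist of E by n), Thm. 1.5 (p0003 L25–L27: E(ℚ(√m*))⁻ ≅ E^{(m)}(ℚ))]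
[cite: RubinSilverberg2002, §1] -/
theorem congruentNumberCurve_eq_quadraticTwist_pos (N : ℕ) :
    congruentNumberCurve N = (congruentNumberCurve 1).quadraticTwist (N : ℚ) := by
  ext <;> simp [congruentNumberCurve, quadraticTwist, b₂, b₄, b₆]
  ring

/-- **The transfer `E_N(ℚ) →+ E(H)`, `(x, y) ↦ (x/θ², y/θ³)`, along a square root `θ` of `+N`** (the REAL quadratic
twist: "`E(ℚ(√m*))⁻ ≅ E^{(m)}(ℚ)`" with `m* = m > 0`, Tian Thm. 1.5 for `n ≡ 5 (mod 8)`; Prop. 4.2: "`2y_{p₀} ∈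
E(ℚ(√p₀))⁻`"). The tree's `transferE` is the same composition for `θ² = −N`.
[cite: Tian2014, Thm. 1.5 (p0003 L25–L27), Prop. 4.2 (p0019 L74–L79)] [cite: SilvermanAEC2009, X.5 Cor. 5.4] -/
def transferEPos (N : ℕ) {H : Type} [Field H] [CharZero H] (θ : H)
    (hθ2 : θ ^ 2 = algebraMap ℚ H (N : ℚ)) (hθ : θ ≠ 0) :
    (congruentNumberCurve N).toAffine.Point →+ EPoint H :=
  (untwistEquivAt (congruentNumberCurve 1) hθ2 hθ).toAddMonoidHom.comp
    ((W2.ιK ((congruentNumberCurve 1).quadraticTwist (N : ℚ)) H).comp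
      (Affine.Point.congrEquiv (congruentNumberCurve_eq_quadraticTwist_pos N)).toAddMonoidHom)

variable (N : ℕ) {H : Type} [Field H] [CharZero H]

/-- Every `g ∈ Gal(H/ℚ)` sends a square root `θ` of `N` to `±θ`. [cite: Tian2014, Prop. 4.2 proof (p0020 L12–L15)] [folklore] -/
theorem gal_sqrt_pos_eq_or_eq_neg (θ : H) (hθ2 : θ ^ 2 = algebraMap ℚ H (N : ℚ)) (g : H ≃ₐ[ℚ] H) :
    g θ = θ ∨ g θ = -θ := by
  have : (g θ) ^ 2 = θ ^ 2 := by rw [← map_pow, hθ2, AlgEquiv.commutes]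
  exact sq_eq_sq_iff_eq_or_eq_neg.mp this

/-- **Transfer images are fixed by every automorphism fixing `θ = √N`**: `g_*(transferEPos y′) = transferEPos y′`
when `g θ = θ`. [cite: Tian2014, Prop. 4.2 proof (p0020 L12–L15)] [cite: Monsky1990MockHeegner, Def. 4.2 (p. 56)] -/
theorem act_transferEPos_of_fix (θ : H) (hθ2 : θ ^ 2 = algebraMap ℚ H (N : ℚ)) (hθ : θ ≠ 0)
    (g : H ≃ₐ[ℚ] H) (hg : g θ = θ) (y' : (congruentNumberCurve N).toAffine.Point) :
    WeierstrassCurve.Affine.Point.map (W' := congruentNumberCurve 1) g.toAlgHom (transferEPos N θ hθ2 hθ y') =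
      transferEPos N θ hθ2 hθ y' := by
  simp only [transferEPos, AddMonoidHom.comp_apply, AddEquiv.coe_toAddMonoidHom]
  rw [map_untwistEquivAt_of_eq (congruentNumberCurve 1) hθ2 hθ hθ2 hθ g.toAlgHom hg]
  congr 1
  exact map_ιK_eq _ g _

/-- **Transfer images are negated by every automorphism moving `θ = √N`**: `g_*(transferEPos y′) = −transferEPos y′`
when `g θ = −θ` ("`E(ℚ(√p₀))⁻`"). [cite: Tian2014, Prop. 4.2 proof (p0020 L12–L15)] [cite: Monsky1990MockHeegner, Def. 4.2 (p. 56)] -/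
theorem act_transferEPos_of_neg (θ : H) (hθ2 : θ ^ 2 = algebraMap ℚ H (N : ℚ)) (hθ : θ ≠ 0)
    (g : H ≃ₐ[ℚ] H) (hg : g θ = -θ) (y' : (congruentNumberCurve N).toAffine.Point) :
    WeierstrassCurve.Affine.Point.map (W' := congruentNumberCurve 1) g.toAlgHom (transferEPos N θ hθ2 hθ y') =
      -transferEPos N θ hθ2 hθ y' := by
  simp only [transferEPos, AddMonoidHom.comp_apply, AddEquiv.coe_toAddMonoidHom]
  rw [map_untwistEquivAt_of_eq_neg (congruentNumberCurve 1) hθ2 hθ hθ2 hθ g.toAlgHom hg]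
  congr 2
  exact map_ιK_eq _ g _

variable [FiniteDimensional ℚ H] [IsGalois ℚ H]

/-- **A point of `E(H)` is the transfer of a rational point of `E_N` as soon as it is fixed by every `g` fixing
`θ = √N` and negated by every `g` sending `θ` to `−θ`** ("`2y_{p₀} ∈ E(ℚ(√p₀))⁻`", Prop. 4.2; "`E(ℚ(√m*))⁻`",
Thm. 1.5). Galois descent of the coordinates `X` and `Y/θ` (`IsGalois.mem_range_algebraMap_iff_fixed`) — the
`θ² = +N` twin of the tree's `exists_transferE_eq_of_forall_gal`.
[cite: Tian2014, Prop. 4.2 proof (p0020 L12–L15), Thm. 1.5 (p0003 L25–L27)] [cite: Monsky1990MockHeegner, Def. 4.2 (p. 56), Lemma 4.3 (p. 56)] -/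
theorem exists_transferEPos_eq_of_forall_gal (θ : H) (hθ2 : θ ^ 2 = algebraMap ℚ H (N : ℚ)) (hθ : θ ≠ 0)
    (P : EPoint H)
    (hfix : ∀ g : H ≃ₐ[ℚ] H, g θ = θ →
      WeierstrassCurve.Affine.Point.map (W' := congruentNumberCurve 1) g.toAlgHom P = P)
    (hneg : ∀ g : H ≃ₐ[ℚ] H, g θ = -θ →
      WeierstrassCurve.Affine.Point.map (W' := congruentNumberCurve 1) g.toAlgHom P = -P) :
    ∃ y' : (congruentNumberCurve N).toAffine.Point, transferEPos N θ hθ2 hθ y' = P := by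
  rcases P with _ | ⟨X, Y, h⟩
  · exact ⟨0, map_zero _⟩
  -- the coordinates `X` and `Y/θ` are fixed by the whole Galois group
  have hX : ∀ g : H ≃ₐ[ℚ] H, g X = X := by
    intro g
    rcases gal_sqrt_pos_eq_or_eq_neg N θ hθ2 g with hg | hg
    · have := hfix g hg
      rw [WeierstrassCurve.Affine.Point.map_some] at this
      exact (WeierstrassCurve.Affine.Point.some.inj this).1
    · have := hneg g hg
      rw [WeierstrassCurve.Affine.Point.map_some, WeierstrassCurve.Affine.Point.neg_some] at this
      exact (WeierstrassCurve.Affine.Point.some.inj this).1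
  have hY : ∀ g : H ≃ₐ[ℚ] H, g (Y / θ) = Y / θ := by
    intro g
    rcases gal_sqrt_pos_eq_or_eq_neg N θ hθ2 g with hg | hg
    · have := hfix g hg
      rw [WeierstrassCurve.Affine.Point.map_some] at this
      have h1 : g Y = Y := (WeierstrassCurve.Affine.Point.some.inj this).2
      rw [map_div₀, hg, h1]
    · have := hneg g hg
      rw [WeierstrassCurve.Affine.Point.map_some, WeierstrassCurve.Affine.Point.neg_some] at this
      have h2 : g Y = -Y := by
        have := (WeierstrassCurve.Affine.Point.some.inj this).2
        rwa [negY_baseChange_of_isCharNeTwoNF'] at this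
      rw [map_div₀, hg, h2, neg_div_neg_eq]
  obtain ⟨x₀, hx₀⟩ := (IsGalois.mem_range_algebraMap_iff_fixed X).mpr hX
  obtain ⟨y₀, hy₀⟩ := (IsGalois.mem_range_algebraMap_iff_fixed (Y / θ)).mpr hY
  have hYθ : Y = θ * algebraMap ℚ H y₀ := by rw [hy₀]; field_simp
  -- the preimage of the point under the untwisting isomorphism has rational coordinates
  obtain ⟨P', hP'e⟩ : ∃ P', untwistEquivAt (congruentNumberCurve 1) hθ2 hθ P' = .some X Y h :=
    ⟨_, (untwistEquivAt (congruentNumberCurve 1) hθ2 hθ).apply_symm_apply _⟩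
  rcases P' with _ | ⟨x', y', h'⟩
  · exfalso
    have h0 : untwistEquivAt (congruentNumberCurve 1) hθ2 hθ 0 = .some X Y h := hP'e
    rw [map_zero] at h0
    exact WeierstrassCurve.Affine.Point.some_ne_zero _ h0.symm
  obtain ⟨h'', he'⟩ := untwistEquivAt_some (congruentNumberCurve 1) hθ2 hθ h'
  have hxy := hP'e
  rw [he'] at hxy
  obtain ⟨hx', hy'⟩ := WeierstrassCurve.Affine.Point.some.inj hxy
  -- `x' = θ² X = N x₀`, `y' = θ³ Y = N² y₀` are rational
  have hx'' : x' = algebraMap ℚ H ((N : ℚ) * x₀) := by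
    have : x' = θ ^ 2 * X := by
      rw [← hx']; field_simp
    rw [this, hθ2, ← hx₀, map_mul]
  have hy'' : y' = algebraMap ℚ H ((N : ℚ) ^ 2 * y₀) := by
    have : y' = θ ^ 3 * Y := by
      rw [← hy']; field_simp
    rw [this, hYθ, show θ ^ 3 * (θ * algebraMap ℚ H y₀) = (θ ^ 2) ^ 2 * algebraMap ℚ H y₀ by ring, hθ2,
      map_mul, map_pow]
  subst hx'' hy''
  -- descend nonsingularity to `ℚ`
  have hQ : ((congruentNumberCurve 1).quadraticTwist (N : ℚ)).toAffine.Nonsingular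
      ((N : ℚ) * x₀) ((N : ℚ) ^ 2 * y₀) :=
    (WeierstrassCurve.Affine.baseChange_nonsingular (W := (congruentNumberCurve 1).quadraticTwist (N : ℚ))
      (f := Algebra.ofId ℚ H) (Algebra.ofId ℚ H).injective _ _).mp h'
  refine ⟨(WeierstrassCurve.Affine.Point.congrEquiv (congruentNumberCurve_eq_quadraticTwist_pos N)).symm
    (.some _ _ hQ), ?_⟩
  simp only [transferEPos, AddMonoidHom.comp_apply, AddEquiv.coe_toAddMonoidHom, AddEquiv.apply_symm_apply]
  obtain ⟨hQ', hι⟩ := ιK_some (H := H) _ hQ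
  rw [hι]
  exact hP'e

end TransferPos

namespace CMPointDataOne

variable {n : ℕ}

/-- A square root `θ` of `n ≠ 0` in `H` is non-zero. [cite: Tian2014, Prop. 4.2 (p0019 L74–L79: ℚ(√p₀))] [folklore] -/
theorem ne_zero_of_sq_eq_natCast (D : CMPointDataOne n) (hn : n ≠ 0) {θ : D.H} (hθ : θ ^ 2 = (n : D.H)) :
    θ ≠ 0 := by
  intro h
  rw [h, zero_pow two_ne_zero, eq_comm, Nat.cast_eq_zero] at hθ
  exact hn hθ

/-- A square root `θ` of `n` in `H` squares to the image of `n ∈ ℚ` (plumbing for the transfer).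
[cite: Tian2014, Prop. 4.2 (p0019 L74–L79)] [folklore] -/
theorem sq_eq_algebraMap_of_sq_eq_natCast (D : CMPointDataOne n) {θ : D.H} (hθ : θ ^ 2 = (n : D.H)) :
    θ ^ 2 = algebraMap ℚ D.H (n : ℚ) := by
  rw [hθ, map_natCast]

/-- **The REAL twist transfer `E_n(ℚ) →+ E(H)` along a square root `θ = √n ∈ H`**: "`E(ℚ(√p₀))⁻ ≅ E^{(p₀)}(ℚ)`"
(Prop. 4.2; Thm. 1.5 with `m* = m = n ≡ 5 (mod 8)`). [cite: Tian2014, Prop. 4.2 (p0019 L74–L79), Thm. 1.5 (p0003 L25–L27)] -/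
def transferPos (D : CMPointDataOne n) (hn : n ≠ 0) {θ : D.H} (hθ : θ ^ 2 = (n : D.H)) :
    (congruentNumberCurve n).toAffine.Point →+ EPoint D.H :=
  transferEPos n θ (D.sq_eq_algebraMap_of_sq_eq_natCast hθ) (D.ne_zero_of_sq_eq_natCast hn hθ)

end CMPointDataOne

/-! ## §5 `E(H)[4] = E(H)[2]` over a field containing neither `√−1` nor `√2` -/

section FourTorsionAbsent

variable {H : Type} [Field H] [CharZero H]

/-- **Over a field `H` of characteristic `0` in which neither `−1` nor `2` is a square, every `4`-torsion point of
`E : y² = x³ − x` is `2`-torsion** (`E(H)[4] = E(H)[2]`; Tian: "`E[4] ∩ E(ℚ(√p₀)) = E[2]`", the points of exact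
order `4` having `x ∈ {±i, ±1 ± √2}`). On coordinates: `2P ∈ E[2]`; `2P = (0,0)` forces `x² = −1`, `2P = (±1, 0)`
forces `(x ∓ 1)² = 2` (the duplication formula `x(2P) = ρ₀(P)²`, the tree's `Monsky1990.exists_two_nsmul_some_eq`).
[cite: Tian2014, §2 (p0008 L34–L40), Prop. 4.2 proof (p0020 L19–L21)] [cite: SilvermanAEC2009, III.2.3] -/
theorem two_nsmul_eq_zero_of_two_nsmul_two_nsmul_eq_zero_of_no_sqrt (hneg : ∀ x : H, x ^ 2 ≠ -1)
    (htwo : ∀ s : H, s ^ 2 ≠ 2) (P : EPoint H) (hP : (2 : ℕ) • ((2 : ℕ) • P) = 0) : (2 : ℕ) • P = 0 := by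
  rcases eq_of_two_nsmul_eq_zero _ hP with h2P | h2P | h2P | h2P
  · exact h2P
  all_goals
    exfalso
    rcases P with _ | ⟨x, y, h⟩
    · rw [← WeierstrassCurve.Affine.Point.zero_def, smul_zero] at h2P
      exact WeierstrassCurve.Affine.Point.some_ne_zero _ h2P.symm
    have heq : y ^ 2 = x ^ 3 - x := sq_eq_of_nonsingular h
    have hy : y ≠ 0 := by
      intro hy0
      rw [two_nsmul, WeierstrassCurve.Affine.Point.add_self_of_Y_eq (by rw [negY_eq, hy0, neg_zero])] at h2P
      exact WeierstrassCurve.Affine.Point.some_ne_zero _ h2P.symm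
    obtain ⟨y₂, h₂, h2eq⟩ := exists_two_nsmul_some_eq h hy
    have hrho : rho 0 x y * (2 * y) = x ^ 2 + 1 := by
      unfold rho
      rw [div_mul_cancel₀ _ (mul_ne_zero two_ne_zero hy)]
      ring
    have hx₂ : rho 0 x y ^ 2 * (4 * y ^ 2) = (x ^ 2 + 1) ^ 2 := by rw [← hrho]; ring
    rw [h2eq] at h2P
    have hX := (WeierstrassCurve.Affine.Point.some.inj h2P).1
  · -- `2P = (0,0)`: `x² = −1`
    have hx2 : x ^ 2 = -1 := by
      rw [hX, zero_mul] at hx₂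
      have h0 : (x ^ 2 + 1) ^ 2 = 0 := hx₂.symm
      have := pow_eq_zero_iff (n := 2) (by norm_num) |>.mp h0
      linear_combination this
    exact hneg x hx2
  · -- `2P = (1,0)`: `(x − 1)² = 2`
    have hs : (x - 1) ^ 2 = 2 := by
      rw [hX, one_mul] at hx₂
      have key : (x ^ 2 - 2 * x - 1) ^ 2 = 0 := by linear_combination -hx₂ + 4 * heq
      have := pow_eq_zero_iff (n := 2) (by norm_num) |>.mp key
      linear_combination this
    exact htwo _ hs
  · -- `2P = (−1,0)`: `(x + 1)² = 2`
    have hs : (x + 1) ^ 2 = 2 := by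
      rw [hX, neg_one_mul] at hx₂
      have key : (x ^ 2 + 2 * x - 1) ^ 2 = 0 := by linear_combination -hx₂ - 4 * heq
      have := pow_eq_zero_iff (n := 2) (by norm_num) |>.mp key
      linear_combination this
    exact htwo _ hs

end FourTorsionAbsent

end Literature.NumberTheory.EllipticCurves.Tian2014

end
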